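import Mathlib
import HarnessLib.Audit
import Summits.PneNP.PneNP.Theorems.PstarGapTwoReadersProof
import Summits.PneNP.PneNP.Theorems.PstarGConstraint

/-!
# G-constraint systems with empty core are graph-quadratic systems (ROUND-24, GAPTWO-PLAN §4 S3, base case `J₀ = ∅`)

FRONTIER range-avoidance ladder, rung F-N3, ROUND 24 (cell `pnp-ideate`; restricted-model proof complexity — nothing here bears
on `P` versus `NP`).

T24.19 in the G-constraint language of the terminal normal form (`PstarGapTwoTerminal`, planner item S3 of `GAPTWO-PLAN.md`, case
of an EMPTY core): a system `𝒲` of G-constraints `(C, G, b)` (`PstarGapOneAll.gval`) on a pure instance with simple overlaps and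
maximum degree `Δ` that is UNSATISFIABLE outright and has the per-monomial flip property (for every monomial output `g` some
assignment satisfies exactly the constraints whose monomial set avoids `g` — (M′) of the terminal form) is, read on the graph of
AND edges of its monomial outputs, an unsat EDGE-MINIMAL graph-quadratic system (`PstarGraphQuadGap`): `gval (C, G) = qval (G's
edges, C)` (`qval_gcon`).  Hence (`card_monomials_le_of_two`) with at most two constraints the monomial outputs number at most
`8Δ²` (`PstarGraphQuadGapTwo.graphQuadGapTwo`, T24.11c), and with at most one genuinely quadratic constraint at most `2Δ²·|𝒲|`
(`card_monomials_le_of_quadCount_le_one`, T24.11a).  Corollary for terminal forms: if the core is empty then `|J| ≤ 8Δ²`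
(`card_le_of_core_empty`).
-/

set_option linter.dupNamespace false

open Finset Literature.Computability.Complexity
open Summit.PneNP.PneNP.Theorems.PstarPDT (parity)
open Summit.PneNP.PneNP.Theorems.PstarSALevel (varSet SimpleOverlap)
open Summit.PneNP.PneNP.Theorems.PstarGapLemma (MaxDegree)
open Summit.PneNP.PneNP.Theorems.PstarGapLinearised (andPair andPair_subset_varSet)
open Summit.PneNP.PneNP.Theorems.PstarGapOneAll (gval)
open Summit.PneNP.PneNP.Theorems.PstarGraphQuadGap (Edge QCon qval QHolds Simple EdgeMaxDegree Supported Unsat EdgeMinimal quadCount)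
open Summit.PneNP.PneNP.Theorems.PstarGraphQuadGapOne (graphQuadGapOne)
open Summit.PneNP.PneNP.Theorems.PstarGraphQuadGapTwo (graphQuadGapTwo)
open Summit.PneNP.PneNP.Theorems.PstarGapTwoReadersProof (edge edge_injective mem_andPair_of_edge simple_edges edgeMaxDegree_edges)

namespace Summit.PneNP.PneNP.Theorems.PstarGSystemGraphGap

variable {n m : ℕ}

/-- The graph-quadratic constraint of a G-constraint: quadratic part = AND edges of the monomial outputs, same linear part and
constant. -/
def gcon (I : LocalMap 4 n m) (w : Finset (Fin n) × Finset (Fin m) × Bool) : QCon n := (w.2.1.image (edge I), w.1, w.2.2)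

/-- **`gval = qval`** on the AND-edge graph (distinct outputs have distinct edges under simple overlaps). -/
theorem qval_gcon (I : LocalMap 4 n m) (hI : I.IsPure xorAndPred) (hS : SimpleOverlap I) (w : Finset (Fin n) × Finset (Fin m) × Bool)
    (z : Fin n → Bool) : qval (gcon I w) z = gval I w.1 w.2.1 z := by
  classical
  have hcard : ((w.2.1.image (edge I)).filter fun e => z e.1 = true ∧ z e.2 = true).card =
      (w.2.1.filter fun g => z (I.vars g 2) = true ∧ z (I.vars g 3) = true).card := by
    rw [filter_image, card_image_of_injOn fun g _ h _ he => edge_injective I hI hS he]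
    exact congrArg Finset.card (filter_congr fun g _ => by
      show (z (edge I g).1 = true ∧ z (edge I g).2 = true) ↔ (z (I.vars g 2) = true ∧ z (I.vars g 3) = true)
      unfold PstarGapTwoReadersProof.edge
      rcases le_total (I.vars g 2) (I.vars g 3) with h | h
      · rw [min_eq_left h, max_eq_right h]
      · rw [min_eq_right h, max_eq_left h, and_comm])
  unfold PstarGraphQuadGap.qval PstarGapOneAll.gval
  rw [show (gcon I w).1 = w.2.1.image (edge I) from rfl, show (gcon I w).2.1 = w.1 from rfl, hcard, Bool.xor_comm]

/-- Membership of an edge in the quadratic part of `gcon`. -/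
theorem edge_mem_gcon_iff (I : LocalMap 4 n m) (hI : I.IsPure xorAndPred) (hS : SimpleOverlap I)
    (w : Finset (Fin n) × Finset (Fin m) × Bool) (g : Fin m) : edge I g ∈ (gcon I w).1 ↔ g ∈ w.2.1 := by
  classical
  unfold gcon
  rw [mem_image]
  constructor
  · rintro ⟨g', hg', he⟩
    rwa [← edge_injective I hI hS he]
  · exact fun h => ⟨g, h, rfl⟩

/-- **The reduction**: an unsat G-system with the per-monomial flip property is an unsat, edge-minimal, supported graph-quadratic
system on the simple bounded-degree graph of its monomial edges, with as many edges as monomial outputs and at most as many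
constraints. -/
theorem reduction {Δ : ℕ} (I : LocalMap 4 n m) (hI : I.IsPure xorAndPred) (hS : SimpleOverlap I) (hD : MaxDegree Δ I)
    (𝒲 : Finset (Finset (Fin n) × Finset (Fin m) × Bool))
    (hU : ¬ ∃ z : Fin n → Bool, ∀ w ∈ 𝒲, gval I w.1 w.2.1 z = w.2.2)
    (hflip : ∀ g ∈ 𝒲.biUnion (fun w => w.2.1), ∃ z : Fin n → Bool, ∀ w ∈ 𝒲, (gval I w.1 w.2.1 z = w.2.2 ↔ g ∉ w.2.1)) :
    ∃ (E : Finset (Edge n)) (W' : Finset (QCon n)), Simple E ∧ EdgeMaxDegree Δ E ∧ Supported E W' ∧ Unsat W' ∧ EdgeMinimal E W' ∧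
      (𝒲.biUnion fun w => w.2.1).card = E.card ∧ W'.card ≤ 𝒲.card ∧ quadCount W' ≤ (𝒲.filter fun w => w.2.1 ≠ ∅).card := by
  classical
  set M := 𝒲.biUnion fun w => w.2.1 with hM
  refine ⟨M.image (edge I), 𝒲.image (gcon I), simple_edges I hI M, edgeMaxDegree_edges I hD M, ?_, ?_, ?_,
    (card_image_of_injOn fun g _ h _ he => edge_injective I hI hS he).symm, card_image_le, ?_⟩
  · -- supported
    intro w' hw'
    obtain ⟨w, hw, rfl⟩ := mem_image.1 hw'
    unfold gcon
    exact image_subset_image (subset_biUnion_of_mem (fun w => w.2.1) hw)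
  · -- unsat
    rintro ⟨a, ha⟩
    refine hU ⟨a, fun w hw => ?_⟩
    have := ha _ (mem_image_of_mem _ hw)
    unfold PstarGraphQuadGap.QHolds at this
    rwa [qval_gcon I hI hS] at this
  · -- edge-minimal
    intro e he
    obtain ⟨g, hg, rfl⟩ := mem_image.1 he
    obtain ⟨z, hz⟩ := hflip g hg
    refine ⟨z, fun w' hw' => ?_⟩
    obtain ⟨w, hw, rfl⟩ := mem_image.1 hw'
    unfold PstarGraphQuadGap.QHolds
    rw [qval_gcon I hI hS, edge_mem_gcon_iff I hI hS]
    exact hz w hw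
  · -- quadratic count
    unfold PstarGraphQuadGap.quadCount
    calc ((𝒲.image (gcon I)).filter fun w' => w'.1 ≠ ∅).card
        ≤ ((𝒲.filter fun w => w.2.1 ≠ ∅).image (gcon I)).card := by
          refine card_le_card fun w' hw' => ?_
          obtain ⟨hw', hne⟩ := mem_filter.1 hw'
          obtain ⟨w, hw, rfl⟩ := mem_image.1 hw'
          refine mem_image.2 ⟨w, mem_filter.2 ⟨hw, fun h0 => hne ?_⟩, rfl⟩
          unfold gcon
          rw [h0, image_empty]
      _ ≤ _ := card_image_le

/-- **S3, base case (two constraints)**: the monomial outputs of an unsat G-system with at most two constraints and the flip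
property number at most `8Δ²`. -/
theorem card_monomials_le_of_two {Δ : ℕ} (I : LocalMap 4 n m) (hI : I.IsPure xorAndPred) (hS : SimpleOverlap I) (hD : MaxDegree Δ I)
    (𝒲 : Finset (Finset (Fin n) × Finset (Fin m) × Bool)) (h𝒲 : 𝒲.card ≤ 2)
    (hU : ¬ ∃ z : Fin n → Bool, ∀ w ∈ 𝒲, gval I w.1 w.2.1 z = w.2.2)
    (hflip : ∀ g ∈ 𝒲.biUnion (fun w => w.2.1), ∃ z : Fin n → Bool, ∀ w ∈ 𝒲, (gval I w.1 w.2.1 z = w.2.2 ↔ g ∉ w.2.1)) :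
    (𝒲.biUnion fun w => w.2.1).card ≤ 8 * Δ ^ 2 := by
  obtain ⟨E, W', hSi, hΔ, hsup, hu, hm, hcard, hW', hq⟩ := reduction I hI hS hD 𝒲 hU hflip
  have hq2 : quadCount W' ≤ 2 := hq.trans ((card_filter_le _ _).trans h𝒲)
  calc (𝒲.biUnion fun w => w.2.1).card = E.card := hcard
    _ ≤ 4 * Δ ^ 2 * W'.card := graphQuadGapTwo Δ n E W' hSi hΔ hsup hu hm hq2
    _ ≤ 4 * Δ ^ 2 * 2 := Nat.mul_le_mul_left _ (hW'.trans h𝒲)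
    _ = 8 * Δ ^ 2 := by ring

/-- **One genuinely quadratic constraint** (any number of affine ones): the monomial outputs number at most `2Δ²·|𝒲|`. -/
theorem card_monomials_le_of_quadCount_le_one {Δ : ℕ} (I : LocalMap 4 n m) (hI : I.IsPure xorAndPred) (hS : SimpleOverlap I)
    (hD : MaxDegree Δ I) (𝒲 : Finset (Finset (Fin n) × Finset (Fin m) × Bool)) (h1 : (𝒲.filter fun w => w.2.1 ≠ ∅).card ≤ 1)
    (hU : ¬ ∃ z : Fin n → Bool, ∀ w ∈ 𝒲, gval I w.1 w.2.1 z = w.2.2)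
    (hflip : ∀ g ∈ 𝒲.biUnion (fun w => w.2.1), ∃ z : Fin n → Bool, ∀ w ∈ 𝒲, (gval I w.1 w.2.1 z = w.2.2 ↔ g ∉ w.2.1)) :
    (𝒲.biUnion fun w => w.2.1).card ≤ 2 * Δ ^ 2 * 𝒲.card := by
  obtain ⟨E, W', hSi, hΔ, hsup, hu, hm, hcard, hW', hq⟩ := reduction I hI hS hD 𝒲 hU hflip
  calc (𝒲.biUnion fun w => w.2.1).card = E.card := hcard
    _ ≤ 2 * Δ ^ 2 * W'.card := graphQuadGapOne Δ n E W' hSi hΔ hsup hu hm (hq.trans h1)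
    _ ≤ 2 * Δ ^ 2 * 𝒲.card := Nat.mul_le_mul_left _ hW'

/-- **Terminal forms with an empty core**: if `(J, W)` with `|W| ≤ 2` has a terminal form whose core is empty (every output folded),
then `|J| ≤ 8Δ²`.  Stated on the terminal data: monomial sets inside `J` and covering it, unsat, flip property. -/
theorem card_le_of_core_empty {Δ : ℕ} (I : LocalMap 4 n m) (hI : I.IsPure xorAndPred) (hS : SimpleOverlap I) (hD : MaxDegree Δ I)
    (J : Finset (Fin m)) (𝒲 : Finset (Finset (Fin n) × Finset (Fin m) × Bool)) (h𝒲 : 𝒲.card ≤ 2)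
    (hmono : ∀ w ∈ 𝒲, w.2.1 ⊆ J) (hcov : ∀ g ∈ J, ∃ w ∈ 𝒲, g ∈ w.2.1)
    (hU : ¬ ∃ z : Fin n → Bool, ∀ w ∈ 𝒲, gval I w.1 w.2.1 z = w.2.2)
    (hflip : ∀ g ∈ J, ∃ z : Fin n → Bool, ∀ w ∈ 𝒲, (gval I w.1 w.2.1 z = w.2.2 ↔ g ∉ w.2.1)) : J.card ≤ 8 * Δ ^ 2 := by
  classical
  have hJ : J = 𝒲.biUnion fun w => w.2.1 := by
    ext g
    rw [mem_biUnion]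
    exact ⟨fun hg => hcov g hg, fun ⟨w, hw, hg⟩ => hmono w hw hg⟩
  rw [hJ]
  exact card_monomials_le_of_two I hI hS hD 𝒲 h𝒲 hU fun g hg => hflip g (hJ ▸ hg)

end Summit.PneNP.PneNP.Theorems.PstarGSystemGraphGap
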